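import Summits.Ventures.CertifiedManyBodySolver.Theorems.M3x2EdgeSplitSymReplayShardsB
import HarnessLib

/-!
# Sharded replay — kernel DEMO on the matrix-form toy certificate `toyCertM` (hub-lb-sym-eng-3 g1)
`toyCertM` (17 one-column `gramM` blocks, value −23/4) is replayed in 26 SHARDS at chunk size `c = 0` (the base shard +
one shard per basis row): each per-shard fact `shardOK toyCertM 0 j P_j = true` is its own `decide +kernel` (here the
shipped partial `P_j` is written as the term `canonNF frame (shard j)` instead of a literal — a lander ships literals),
the final fact is one more `decide +kernel`, and `energyDensity_ge_of_shards` assembles them into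
`symValue toyCertM ≤ e₀(1,0,8,7/8)` — standard axioms, no `native_decide`.  Value-trivial (−23/4); API regression only.
No bound of record moves; no summit or crux statement is proved; nothing here predicts superconductivity.
-/

namespace Summit.Ventures.CertifiedManyBodySolver.Theorems.SymReplay.ShardsDemo

open Literature.MathematicalPhysics.QuantumLattice.ThermodynamicLimit

/-- The partials of the demo: shard `j`'s own canonical normal form (a real lander ships these as literals). -/
def demoPartials : List QPoly := [canonNF toyCertM.frame (shardPolyAt toyCertM 0 0), canonNF toyCertM.frame (shardPolyAt toyCertM 0 1), canonNF toyCertM.frame (shardPolyAt toyCertM 0 2), canonNF toyCertM.frame (shardPolyAt toyCertM 0 3), canonNF toyCertM.frame (shardPolyAt toyCertM 0 4), canonNF toyCertM.frame (shardPolyAt toyCertM 0 5), canonNF toyCertM.frame (shardPolyAt toyCertM 0 6), canonNF toyCertM.frame (shardPolyAt toyCertM 0 7), canonNF toyCertM.frame (shardPolyAt toyCertM 0 8), canonNF toyCertM.frame (shardPolyAt toyCertM 0 9), canonNF toyCertM.frame (shardPolyAt toyCertM 0 10), canonNF toyCertM.frame (shardPolyAt toyCertM 0 11), canonNF toyCertM.frame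 (shardPolyAt toyCertM 0 12), canonNF toyCertM.frame (shardPolyAt toyCertM 0 13), canonNF toyCertM.frame (shardPolyAt toyCertM 0 14), canonNF toyCertM.frame (shardPolyAt toyCertM 0 15), canonNF toyCertM.frame (shardPolyAt toyCertM 0 16), canonNF toyCertM.frame (shardPolyAt toyCertM 0 17), canonNF toyCertM.frame (shardPolyAt toyCertM 0 18), canonNF toyCertM.frame (shardPolyAt toyCertM 0 19), canonNF toyCertM.frame (shardPolyAt toyCertM 0 20), canonNF toyCertM.frame (shardPolyAt toyCertM 0 21), canonNF toyCertM.frame (shardPolyAt toyCertM 0 22), canonNF toyCertM.frame (shardPolyAt toyCertM 0 23), canonNF toyCertM.frame (shardPolyAt toyCertM 0 24), canonNF toyCertM.frame (shardPolyAt toyCertM 0 25)]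

/-- 26 shards. -/
theorem demo_len : (shardPolys toyCertM 0).length = demoPartials.length := by decide +kernel

/-- The 26 per-shard facts, each its own kernel evaluation. -/
theorem demo_facts : ShardFacts toyCertM 0 0 demoPartials := by
  unfold demoPartials
  refine ⟨by decide +kernel, ?_⟩
  refine ⟨by decide +kernel, ?_⟩
  refine ⟨by decide +kernel, ?_⟩
  refine ⟨by decide +kernel, ?_⟩
  refine ⟨by decide +kernel, ?_⟩
  refine ⟨by decide +kernel, ?_⟩
  refine ⟨by decide +kernel, ?_⟩
  refine ⟨by decide +kernel, ?_⟩
  refine ⟨by decide +kernel, ?_⟩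
  refine ⟨by decide +kernel, ?_⟩
  refine ⟨by decide +kernel, ?_⟩
  refine ⟨by decide +kernel, ?_⟩
  refine ⟨by decide +kernel, ?_⟩
  refine ⟨by decide +kernel, ?_⟩
  refine ⟨by decide +kernel, ?_⟩
  refine ⟨by decide +kernel, ?_⟩
  refine ⟨by decide +kernel, ?_⟩
  refine ⟨by decide +kernel, ?_⟩
  refine ⟨by decide +kernel, ?_⟩
  refine ⟨by decide +kernel, ?_⟩
  refine ⟨by decide +kernel, ?_⟩
  refine ⟨by decide +kernel, ?_⟩
  refine ⟨by decide +kernel, ?_⟩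
  refine ⟨by decide +kernel, ?_⟩
  refine ⟨by decide +kernel, ?_⟩
  refine ⟨by decide +kernel, ?_⟩
  exact trivial

/-- The final fact: the shipped partials cancel (up to licensed identifications). -/
theorem demo_final : isZero (canonNF toyCertM.frame demoPartials.flatten) = true := by decide +kernel

/-- `toyCertM` is well formed. -/
theorem demo_wf : wellFormed toyCertM = true := by decide +kernel

/-- **The sharded pipeline end to end in the kernel**: `symValue toyCertM ≤ e₀(1,0,8,7/8)`. -/
theorem toyCertM_energy_ge_sharded : ((symValue toyCertM : ℚ) : ℝ) ≤ energyDensityTT' 1 0 8 (7 / 8) :=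
  energyDensity_ge_of_shards toyCertM demo_wf 0 demoPartials demo_len demo_facts demo_final

end Summit.Ventures.CertifiedManyBodySolver.Theorems.SymReplay.ShardsDemo
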